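import Literature.MathematicalPhysics.QuantumLattice.InfVolFermionState
import Literature.MathematicalPhysics.QuantumLattice.HubbardBondAlgebra
import HarnessLib

/-!
# Locality of the second quantisation `Γ(φ)` of a site embedding: `Γ(φ) 𝔄_Λ ⊆ 𝔄(φ Λ)` and
# graded commutativity with even operators away from `φ Λ`

Topic `Literature/MathematicalPhysics/QuantumLattice`; namespace
`Literature.MathematicalPhysics.QuantumLattice` (the file path). For an injection of sites
`φ : Λ ↪ Λ'` the `*`-homomorphism `fermionEmbed φ` (`c_{xσ} ↦ c_{φ x, σ}`, `InfVolFermionState.lean`)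
maps every operator of the Fock space over `Λ` into the CAR subalgebra `𝔄(S)`
(`carSubalgebra`, `FermionTraceFactorization.lean`) of the orbitals `S = orbs (φ Λ)` over the image
sites (`fermionEmbed_mem_carSubalgebra`), and even operators into the even subalgebra
(`fermionEmbed_mem_carEvenSubalgebra`); consequently an embedded local observable commutes with
every even operator supported on orbitals disjoint from the image
(`commute_fermionEmbed_of_mem_carEvenSubalgebra`, from the graded commutativity
`commute_of_mem_carEvenSubalgebra`). Bratteli–Robinson II §5.2.2 (the CAR algebra is the inductive
limit of the local algebras `𝔄(Λ)`; even elements of disjoint regions commute). No definition, no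
named fact.
-/

noncomputable section

namespace Literature.MathematicalPhysics.QuantumLattice

open Matrix Finset HubbardWave0

variable {Λ Λ' : Type*} [LinearOrder Λ] [Fintype Λ] [LinearOrder Λ'] [Fintype Λ']

/-- `Γ(φ)` maps the generator `c^♯_i`, `i = (x, σ)`, to the generator `c^♯_{(φ x, σ)}`. [folklore] -/
theorem fermionEmbed_letterOp (φ : Λ ↪ Λ') (l : JWLetter (Orb Λ)) :
    fermionEmbed φ (letterOp l) = letterOp (orb (φ (ofLex l.1).1) (ofLex l.1).2, l.2) := by
  rcases l with ⟨i, b⟩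
  cases b
  · simp only [letterOp, Bool.false_eq_true, ↓reduceIte]
    exact fermionEmbed_annihilation' φ i
  · simp only [letterOp, ↓reduceIte]
    exact fermionEmbed_creation' φ i

omit [LinearOrder Λ] [LinearOrder Λ'] [Fintype Λ'] in
/-- The orbitals over an image site belong to `orbs (φ Λ)`. [folklore] -/
theorem orb_apply_mem_orbs_map (φ : Λ ↪ Λ') (x : Λ) (σ : Fin 2) :
    orb (φ x) σ ∈ orbs ((Finset.univ : Finset Λ).map φ) :=
  orb_mem_orbs.2 (Finset.mem_map_of_mem _ (Finset.mem_univ x))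

/-- **`Γ(φ) 𝔄_Λ ⊆ 𝔄(φ Λ)`**: the second quantisation of a site embedding maps every operator of the
Fock space over `Λ` into the CAR subalgebra of the orbitals over the image sites (it maps the
generators `c^♯_{xσ}` to generators `c^♯_{φ x, σ}`). [cite: BratteliRobinsonII1997, §5.2.2] -/
theorem fermionEmbed_mem_carSubalgebra (φ : Λ ↪ Λ') (a : Matrix (Finset (Orb Λ)) (Finset (Orb Λ)) ℂ) :
    fermionEmbed φ a ∈ carSubalgebra (orbs ((Finset.univ : Finset Λ).map φ)) := by
  have ha : a ∈ carSubalgebra (Finset.univ : Finset (Orb Λ)) := by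
    rw [carSubalgebra_univ_eq_top]; exact Algebra.mem_top
  have hmap : (carSubalgebra (Finset.univ : Finset (Orb Λ))).map (fermionEmbed φ) ≤
      carSubalgebra (orbs ((Finset.univ : Finset Λ).map φ)) := by
    rw [carSubalgebra, AlgHom.map_adjoin]
    refine Algebra.adjoin_le ?_
    rintro _ ⟨_, ⟨l, -, rfl⟩, rfl⟩
    rw [SetLike.mem_coe, fermionEmbed_letterOp]
    exact letterOp_mem_carSubalgebra (orb_apply_mem_orbs_map φ _ _)
  exact hmap ⟨a, ha, rfl⟩

/-- **`Γ(φ)` preserves evenness**: an even operator (an element of the even CAR subalgebra of all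
orbitals over `Λ`) is mapped into the even CAR subalgebra of the orbitals over the image sites.
[cite: BratteliRobinsonII1997, §5.2.2] -/
theorem fermionEmbed_mem_carEvenSubalgebra (φ : Λ ↪ Λ') {a : Matrix (Finset (Orb Λ)) (Finset (Orb Λ)) ℂ}
    (ha : a ∈ carEvenSubalgebra (Finset.univ : Finset (Orb Λ))) :
    fermionEmbed φ a ∈ carEvenSubalgebra (orbs ((Finset.univ : Finset Λ).map φ)) := by
  have hmap : (carEvenSubalgebra (Finset.univ : Finset (Orb Λ))).map (fermionEmbed φ) ≤
      carEvenSubalgebra (orbs ((Finset.univ : Finset Λ).map φ)) := by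
    rw [carEvenSubalgebra, AlgHom.map_adjoin]
    refine Algebra.adjoin_le ?_
    rintro _ ⟨_, ⟨l, l', -, -, rfl⟩, rfl⟩
    rw [SetLike.mem_coe, map_mul, fermionEmbed_letterOp, fermionEmbed_letterOp]
    exact Algebra.subset_adjoin ⟨_, _, orb_apply_mem_orbs_map φ _ _, orb_apply_mem_orbs_map φ _ _, rfl⟩
  exact hmap ⟨a, ha, rfl⟩

/-- **Graded locality of embedded observables**: an even operator supported on orbitals disjoint from
the image `φ Λ` commutes with every `Γ(φ) a`. [cite: BratteliRobinsonII1997, §5.2.2] -/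
theorem commute_fermionEmbed_of_mem_carEvenSubalgebra (φ : Λ ↪ Λ') (a : Matrix (Finset (Orb Λ)) (Finset (Orb Λ)) ℂ)
    {S : Finset (Orb Λ')} {b : Matrix (Finset (Orb Λ')) (Finset (Orb Λ')) ℂ} (hb : b ∈ carEvenSubalgebra S)
    (hS : Disjoint S (orbs ((Finset.univ : Finset Λ).map φ))) : Commute b (fermionEmbed φ a) :=
  commute_of_mem_carEvenSubalgebra hb (fermionEmbed_mem_carSubalgebra φ a) hS

/-! ### The even operators of the Hubbard Hamiltonian -/

/-- `n_{xσ} ∈ 𝔄⁺(S)` for an orbital set `S ∋ (x, σ)`. [folklore] -/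
theorem numberOp_mem_carEvenSubalgebra {S : Finset (Orb Λ)} {x : Λ} {σ : Fin 2} (h : orb x σ ∈ S) :
    numberOp x σ ∈ carEvenSubalgebra S :=
  creation_mul_annihilation_mem_carEvenSubalgebra h h

/-- The hopping term `Σ_σ c†_{xσ} c_{yσ}` is even and supported on the orbitals over `{x, y}`.
[folklore] -/
theorem sum_creation_mul_annihilation_mem_carEvenSubalgebra {S : Finset (Orb Λ)} {x y : Λ}
    (hx : ∀ σ, orb x σ ∈ S) (hy : ∀ σ, orb y σ ∈ S) :
    ∑ σ : Fin 2, creation (orb x σ) * annihilation (orb y σ) ∈ carEvenSubalgebra S :=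
  Subalgebra.sum_mem _ fun σ _ => creation_mul_annihilation_mem_carEvenSubalgebra (hx σ) (hy σ)

/-- The on-site repulsion `n_{x↑} n_{x↓}` is even and supported on the orbitals over `x`. [folklore] -/
theorem numberOp_mul_numberOp_mem_carEvenSubalgebra {S : Finset (Orb Λ)} {x : Λ} (hx : ∀ σ, orb x σ ∈ S) :
    numberOp x 0 * numberOp x 1 ∈ carEvenSubalgebra S :=
  Subalgebra.mul_mem _ (numberOp_mem_carEvenSubalgebra (hx 0)) (numberOp_mem_carEvenSubalgebra (hx 1))

end Literature.MathematicalPhysics.QuantumLattice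

end
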